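import Literature.NumberTheory.LFunctions.Zhang2022.RepairTiePoints
import Literature.NumberTheory.LFunctions.Zhang2022.RepairSlopeLDL

/-!
# Zhang (2022) §18-margin repair rung, LOCAL ANNEX K0: kernel point floors of `C₂₃₂` at an ARBITRARY
# rational design (all six coordinates free), by the width-0 `LDLᴴ` pivot test

Trunk T-ANT (NumberTheory/LFunctions). Y. Zhang, *Discrete mean estimates and the Landau–Siegel
zero*, arXiv:2211.02515v1 (2022) [Zhang2022LandauSiegel] — **an unrefereed manuscript under
adjudication; nothing here asserts or denies its Theorems 1–2 or any analytic lemma; no claim about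
Landau–Siegel zeros is made.** Rung F-S1R (D-0077), ANNEX slot [Q2-9] "K0 point certificates at the
§points of record" (REPAIR-LEDGER §points P0–P12), seat repair-p5. The verdict of the rung is the
structural theorem `Repair.not_repairable_true_need` (`RepairVerdictAssembly`); the floors below are
reading-level annex numbers (T-print `< 0.001` / T-chain `< 25/3000` literal targets), never inputs of it.

`RepairTiePoints` (p6) certifies floors `m ≤ C232D θ`, `m ≤ C232P θ` at rational points of the ONE-
parameter tie family `θ_tie(ν₁; ι)`; this file does the same at a GENERAL rational design
`θ = (ν₁, ν₂, ν₃; k₁, k₂, k₃; ι; ½)` (`thetaPt`; the §points P4, P5, P8, P9 of record lie off the tie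
family), and replaces the leaf `cmatEncl lit ∧ hermPsdCheck lit V` (which needs an offline integer
eigenbasis `V`) by the `LDLᴴ` PIVOT TEST of `RepairSlopeLDL` run on CONSTANT slope forms
(`EntryS.pivotsPos` with every slope `0`): the leaf datum is the design alone, nothing is computed
outside the kernel.

* `thetaPt ν₁ ν₂ ν₃ k₁ k₂ k₃ ι` (cut₁ = ½); regressions `thetaPt_printed` (= `thetaIota`),
  `thetaPt_tie` (= `thetaTie`); `ptInClass` (the side conditions of `AdmissibleTheta` as decidable
  rational inequalities) and `admissible_thetaPt`;
* `ptEntryF θ` (the ten exact entries of the reduced §18 matrix as constant functions; `ptEntryF_Q :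
  (ptEntryF θ).Q m t = QD θ m`, `ptEntryFP_Q : … = QPm θ m` for the printed-prefactor reading);
* `ptEntryS`, `ptEntrySP` (constant slope forms of p5's `cDiagBL/cCrossBL` and p6's `F··TB` boxes at
  the point intervals `FI.ofRat νᵢ`), flags `ptND` (non-degeneracy: `νᵢ ≠ 0`, `kᵢ ≠ 0`, `k₁ ≠ k₂`,
  `k₂ ≠ k₃` — the cross boxes are the NON-resonant closed forms) and `ptOK`, `ptEntryS_mem/ptEntrySP_mem`;
* leaves `ptCertD/ptCertP ν₁ ν₂ ν₃ k₁ k₂ k₃ m : Bool` and the transfers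
  **`C232D_pt_ge : ptCertD … m = true → ∀ ι, m ≤ C232D (thetaPt … ι)`**, `C232P_pt_ge`, and the
  annex shapes `not_lt_C232D_pt`, `pt_annexD` (`AdmissibleTheta ∧ floor ∧ no target ≤ m met`).

Transcription reading as in `RepairTiePoints`: reduced `𝔠₃` with Zhang's linearised (12.13) windows
(`F··T` of `RepairSection18Forms`), derived (`C232D`) resp. printed (`C232P`) `c₃₄` prefactor. The
resonant designs `k₁ = k₂` (ridge points P6/P7 of the ledger) are outside the closed forms used here.
Pure bookkeeping over landed boxes; no new `Prop` facts.

## References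

* Y. Zhang, arXiv:2211.02515v1 (2022), §2 (2.21)–(2.26), (2.32), §8 (8.19)–(8.23), §9 (9.3)–(9.7),
  §12 (12.13)–(12.15), Lemma 15.1, (17.4), §18 (18.1)–(18.2). [cite: Zhang2022LandauSiegel, §§2, 8, 9, 12, 15, 17, 18]
* S. M. Rump, *Verification of positive definiteness*, BIT 46 (2006) 433–452. [Rump2006]
* R. E. Moore, *Interval Analysis* (1966), Theorem 3.1, §4.4. [Moore1966]
-/

noncomputable section

open Complex Real ComplexConjugate Matrix
open scoped ComplexOrder
open Literature.Analysis.ValidatedNumerics.Numerics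

namespace Literature.NumberTheory.LFunctions.Zhang2022

namespace Repair

/-! ### The general rational design and its admissibility -/

/-- **a general rational design** `θ = (ν₁, ν₂, ν₃; k₁, k₂, k₃; ι₂, ι₃, ι₄; ½)` (cut₁ = ½ as architected,
`Theta.cutAtHalf`). [cite: Zhang2022LandauSiegel, §2 (2.21)–(2.26), §12 (12.1)] -/
def thetaPt (ν1 ν2 ν3 k1 k2 k3 : ℚ) (w2 w3 w4 : ℂ) : Theta where
  nu1 := ν1
  nu2 := ν2
  nu3 := ν3
  k1 := k1
  k2 := k2
  k3 := k3
  iota2 := w2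
  iota3 := w3
  iota4 := w4
  cut1 := 1 / 2

/-- regression: at the printed coordinates `thetaPt` is the printed `ι`-family `thetaIota`.
[cite: Zhang2022LandauSiegel, §2 (2.21)–(2.26)] -/
theorem thetaPt_printed (w2 w3 w4 : ℂ) :
    thetaPt (63/125) (1/2) (249/500) (3/2) (5/2) (3/2) w2 w3 w4 = thetaIota w2 w3 w4 := by
  simp only [thetaPt, thetaIota]; norm_num

/-- regression: on the tie family `(q, ½, ¾ − q/2; 3/2, 5/2, 3/2)` `thetaPt` is p6's `thetaTie`.
[cite: Zhang2022LandauSiegel, §2 (2.21)–(2.26)] -/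
theorem thetaPt_tie (q : ℚ) (w2 w3 w4 : ℂ) :
    thetaPt q (1/2) (3/4 - q/2) (3/2) (5/2) (3/2) w2 w3 w4 = thetaTie q w2 w3 w4 := by
  simp only [thetaPt, thetaTie]; push_cast; ring_nf

/-- the side conditions of `AdmissibleTheta` (class `R` v1) at a rational design, decidable:
`ν₃ < ν₂ < ν₁`, `ν₃ < ½`, `ν₂ ≤ ½ < ν₁ < 1`, `1 < ν₁ + ν₃`, `0 < kᵢ < 5`, `k₁ = k₃`.
[cite: Zhang2022LandauSiegel, §§2, 7, 8, 9, 12, 14, 15] -/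
def ptInClass (ν1 ν2 ν3 k1 k2 k3 : ℚ) : Bool :=
  decide (ν3 < ν2) && decide (ν2 < ν1) && decide (ν3 < 1/2) && decide (ν2 ≤ 1/2) && decide (1/2 < ν1)
    && decide (ν1 < 1) && decide (1 < ν1 + ν3) && decide (0 < k1) && decide (k1 < 5) && decide (0 < k2)
    && decide (k2 < 5) && decide (0 < k3) && decide (k3 < 5) && decide (k1 = k3)

/-- **a rational design passing `ptInClass` is admissible** (for every `ι`). [cite: Zhang2022LandauSiegel, §§2, 7, 8, 9, 12, 14, 15] -/
theorem admissible_thetaPt {ν1 ν2 ν3 k1 k2 k3 : ℚ} (h : ptInClass ν1 ν2 ν3 k1 k2 k3 = true)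
    (w2 w3 w4 : ℂ) : AdmissibleTheta (thetaPt ν1 ν2 ν3 k1 k2 k3 w2 w3 w4) := by
  simp only [ptInClass, Bool.and_eq_true, decide_eq_true_eq] at h
  obtain ⟨⟨⟨⟨⟨⟨⟨⟨⟨⟨⟨⟨⟨h32, h21⟩, h3h⟩, h2h⟩, h1h⟩, h1P⟩, hd⟩, hk1⟩, hk1'⟩, hk2⟩, hk2'⟩, hk3⟩, hk3'⟩, h13⟩ := h
  refine ⟨⟨?_, ?_⟩, ⟨?_, ?_, ?_⟩, ?_, ?_, ?_, ⟨⟨?_, ?_⟩, ⟨?_, ?_⟩, ⟨?_, ?_⟩⟩, ?_⟩ <;>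
    simp only [thetaPt, Theta.belowP, Theta.dualRangesNonempty, Theta.cutAtHalf, Theta.tiedOuterShifts]
  · exact_mod_cast h32
  · exact_mod_cast h21
  · have : ((ν3 : ℚ) : ℝ) < ((1/2 : ℚ) : ℝ) := by exact_mod_cast h3h
    simpa using this
  · have : ((ν2 : ℚ) : ℝ) ≤ ((1/2 : ℚ) : ℝ) := by exact_mod_cast h2h
    simpa using this
  · have : ((1/2 : ℚ) : ℝ) < ((ν1 : ℚ) : ℝ) := by exact_mod_cast h1h
    simpa using this
  · exact_mod_cast h1P
  · have : ((1 : ℚ) : ℝ) < ((ν1 + ν3 : ℚ) : ℝ) := by exact_mod_cast hd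
    simpa using this
  · exact_mod_cast hk1
  · exact_mod_cast hk1'
  · exact_mod_cast hk2
  · exact_mod_cast hk2'
  · exact_mod_cast hk3
  · exact_mod_cast hk3'
  · exact_mod_cast h13

/-! ### The exact entries as constant functions; the matrices `QD`, `QPm` in the `EntryF` layout -/

/-- `c_μμ` is real: `((Re c_μμ : ℝ) : ℂ) = c_μμ`. [cite: Zhang2022LandauSiegel, §8 after (8.23)] -/
private theorem cDiagR_ofReal_re (k ν : ℝ) : (((cDiagR k ν).re : ℝ) : ℂ) = cDiagR k ν := by
  unfold cDiagR; rw [Complex.add_conj, Complex.ofReal_re]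

/-- the ten exact entries of `QD θ` as CONSTANT functions of a dummy cell variable (derived `c₃₄`
prefactor). [cite: Zhang2022LandauSiegel, (2.32), (8.23), (9.7), (18.1)] -/
def ptEntryF (θ : Theta) : EntryF where
  r11 := fun _ => (cDiagR θ.k1 θ.nu1).re
  r22 := fun _ => (cDiagR θ.k2 θ.nu2).re
  r33 := fun _ => (cDiagR θ.k3 θ.nu3).re
  c12 := fun _ => cCrossR θ.k1 θ.k2 θ.nu1 θ.nu2
  c34 := fun _ => cCrossR θ.k2 θ.k3 θ.nu2 θ.nu3
  F20 := fun _ => F20T θ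
  F21 := fun _ => F21T θ
  F30 := fun _ => F30T θ
  F31 := fun _ => F31T θ

/-- the same with the PRINTED `c₃₄` prefactor continued as `ν₂/ν₁` (`QPm`). [cite: Zhang2022LandauSiegel, (9.5)–(9.7)] -/
def ptEntryFP (θ : Theta) : EntryF where
  r11 := fun _ => (cDiagR θ.k1 θ.nu1).re
  r22 := fun _ => (cDiagR θ.k2 θ.nu2).re
  r33 := fun _ => (cDiagR θ.k3 θ.nu3).re
  c12 := fun _ => cCrossR θ.k1 θ.k2 θ.nu1 θ.nu2
  c34 := fun _ => ((θ.nu2 / θ.nu1 : ℝ) : ℂ) * cCrossR θ.k2 θ.k3 θ.nu2 θ.nu3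
  F20 := fun _ => F20T θ
  F21 := fun _ => F21T θ
  F30 := fun _ => F30T θ
  F31 := fun _ => F31T θ

/-- `(ptEntryF θ).Q m t = QD θ m`. [cite: Zhang2022LandauSiegel, (2.32)] -/
theorem ptEntryF_Q (θ : Theta) (m : ℚ) (t : ℝ) : (ptEntryF θ).Q m t = QD θ m := by
  simp only [EntryF.Q, ptEntryF, QD, cDiagR_ofReal_re]

/-- `(ptEntryFP θ).Q m t = QPm θ m`. [cite: Zhang2022LandauSiegel, (2.32), (9.5)–(9.7)] -/
theorem ptEntryFP_Q (θ : Theta) (m : ℚ) (t : ℝ) : (ptEntryFP θ).Q m t = QPm θ m := by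
  simp only [EntryF.Q, ptEntryFP, QPm, cDiagR_ofReal_re]

/-! ### Constant slope forms of the entry boxes at a rational design -/

/-- constant slope forms of the ten entry boxes at `(ν₁, ν₂, ν₃; k₁, k₂, k₃)` (derived prefactor):
p5's `cDiagBL/cCrossBL` (§§8–9) and p6's `F··TB` (§18) at the point intervals `FI.ofRat νᵢ`.
[cite: Zhang2022LandauSiegel, (2.32), (8.23), (9.7), (18.1)] -/
def ptEntryS (ν1 ν2 ν3 k1 k2 k3 : ℚ) : EntryS where
  r11 := SFI.const (cDiagBL k1 (FI.ofRat ν1)).re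
  r22 := SFI.const (cDiagBL k2 (FI.ofRat ν2)).re
  r33 := SFI.const (cDiagBL k3 (FI.ofRat ν3)).re
  c12 := SCB.const (cCrossBL k1 k2 (FI.ofRat ν1) (FI.ofRat ν2))
  c34 := SCB.const (cCrossBL k2 k3 (FI.ofRat ν2) (FI.ofRat ν3))
  F20 := SCB.const (F20TB k1 k3 (FI.ofRat ν1) (FI.ofRat ν3))
  F21 := SCB.const (F21TB k2 k3 (FI.ofRat ν2) (FI.ofRat ν3))
  F30 := SCB.const (F30TB k1 k2 (FI.ofRat ν1) (FI.ofRat ν2))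
  F31 := SCB.const (F31TB k2 (FI.ofRat ν2))

/-- the same with the printed-prefactor `c₃₄` box (scaled by the rational `ν₂/ν₁`). [cite: Zhang2022LandauSiegel, (9.5)–(9.7)] -/
def ptEntrySP (ν1 ν2 ν3 k1 k2 k3 : ℚ) : EntryS where
  r11 := SFI.const (cDiagBL k1 (FI.ofRat ν1)).re
  r22 := SFI.const (cDiagBL k2 (FI.ofRat ν2)).re
  r33 := SFI.const (cDiagBL k3 (FI.ofRat ν3)).re
  c12 := SCB.const (cCrossBL k1 k2 (FI.ofRat ν1) (FI.ofRat ν2))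
  c34 := SCB.const ((cCrossBL k2 k3 (FI.ofRat ν2) (FI.ofRat ν3)).mulFI (FI.ofRat (ν2 / ν1)))
  F20 := SCB.const (F20TB k1 k3 (FI.ofRat ν1) (FI.ofRat ν3))
  F21 := SCB.const (F21TB k2 k3 (FI.ofRat ν2) (FI.ofRat ν3))
  F30 := SCB.const (F30TB k1 k2 (FI.ofRat ν1) (FI.ofRat ν2))
  F31 := SCB.const (F31TB k2 (FI.ofRat ν2))

/-- non-degeneracy of the design for the closed forms used (`νᵢ ≠ 0`, `kᵢ ≠ 0`, non-resonant cross
pairs `k₁ ≠ k₂`, `k₂ ≠ k₃`). [folklore] -/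
def ptND (ν1 ν2 ν3 k1 k2 k3 : ℚ) : Bool :=
  decide (ν1 ≠ 0) && decide (ν2 ≠ 0) && decide (ν3 ≠ 0) && decide (k1 ≠ 0) && decide (k2 ≠ 0)
    && decide (k3 ≠ 0) && decide (k1 ≠ k2) && decide (k2 ≠ k3)

/-- validity flags of all entry boxes at the design. [folklore] -/
def ptOK (ν1 ν2 ν3 k1 k2 k3 : ℚ) : Bool :=
  bDiagOK k1 (FI.ofRat ν1) && bDiagOK k2 (FI.ofRat ν2) && bDiagOK k3 (FI.ofRat ν3)
    && cCrossOK k1 k2 (FI.ofRat ν1) (FI.ofRat ν2) && cCrossOK k2 k3 (FI.ofRat ν2) (FI.ofRat ν3)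
    && slice18OK k1 k2 k3 (FI.ofRat ν1) (FI.ofRat ν2) (FI.ofRat ν3)

variable {ν1 ν2 ν3 k1 k2 k3 : ℚ}

/-- the slice hypotheses of `RepairSection18Boxes` at a rational design. [cite: Moore1966, Theorem 3.1] -/
theorem sliceHyp_thetaPt (hn1 : ν1 ≠ 0) (hn2 : ν2 ≠ 0) (hn3 : ν3 ≠ 0) (hk1 : k1 ≠ 0) (hk2 : k2 ≠ 0)
    (hk3 : k3 ≠ 0) (hok : slice18OK k1 k2 k3 (FI.ofRat ν1) (FI.ofRat ν2) (FI.ofRat ν3) = true)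
    (w2 w3 w4 : ℂ) :
    SliceHyp (thetaPt ν1 ν2 ν3 k1 k2 k3 w2 w3 w4) k1 k2 k3 (FI.ofRat ν1) (FI.ofRat ν2) (FI.ofRat ν3) where
  h1 := by simp only [thetaPt]; exact FI.mem_ofRat ν1
  h2 := by simp only [thetaPt]; exact FI.mem_ofRat ν2
  h3 := by simp only [thetaPt]; exact FI.mem_ofRat ν3
  n1 := by simp only [thetaPt]; exact_mod_cast hn1
  n2 := by simp only [thetaPt]; exact_mod_cast hn2
  n3 := by simp only [thetaPt]; exact_mod_cast hn3
  hk1 := rfl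
  hk2 := rfl
  hk3 := rfl
  k1ne := hk1
  k2ne := hk2
  k3ne := hk3
  ok := hok

/-- the five `§8/§9` entry enclosures under the slice hypotheses (general `θ`, general boxes; the
cross pairs non-resonant). [cite: Moore1966, Theorem 3.1] -/
theorem SliceHyp.mem_cEntries {θ : Theta} {V1 V2 V3 : FI} (H : SliceHyp θ k1 k2 k3 V1 V2 V3)
    (h12 : k1 ≠ k2) (h23 : k2 ≠ k3) (ok1 : bDiagOK k1 V1 = true) (ok2 : bDiagOK k2 V2 = true)
    (ok3 : bDiagOK k3 V3 = true) (ok12 : cCrossOK k1 k2 V1 V2 = true)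
    (ok23 : cCrossOK k2 k3 V2 V3 = true) :
    CB.mem (cDiagR θ.k1 θ.nu1) (cDiagBL k1 V1) ∧ CB.mem (cDiagR θ.k2 θ.nu2) (cDiagBL k2 V2)
      ∧ CB.mem (cDiagR θ.k3 θ.nu3) (cDiagBL k3 V3)
      ∧ CB.mem (cCrossR θ.k1 θ.k2 θ.nu1 θ.nu2) (cCrossBL k1 k2 V1 V2)
      ∧ CB.mem (cCrossR θ.k2 θ.k3 θ.nu2 θ.nu3) (cCrossBL k2 k3 V2 V3) := by
  rw [H.hk1, H.hk2, H.hk3, cDiagR_ratCast, cDiagR_ratCast, cDiagR_ratCast, cCrossR_ratCast,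
    cCrossR_ratCast]
  exact ⟨mem_cDiagBL H.k1ne H.h1 ok1, mem_cDiagBL H.k2ne H.h2 ok2, mem_cDiagBL H.k3ne H.h3 ok3,
    mem_cCrossBL H.k1ne H.k2ne h12 H.h1 H.h2 ok12, mem_cCrossBL H.k2ne H.k3ne h23 H.h2 H.h3 ok23⟩

/-- at a rational design the printed-prefactor ratio `ν₂/ν₁` is the rational `ν₂/ν₁`. [folklore] -/
private theorem thetaPt_ratio (w2 w3 w4 : ℂ) :
    (thetaPt ν1 ν2 ν3 k1 k2 k3 w2 w3 w4).nu2 / (thetaPt ν1 ν2 ν3 k1 k2 k3 w2 w3 w4).nu1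
      = ((ν2 / ν1 : ℚ) : ℝ) := by
  simp only [thetaPt]; push_cast; rfl

/-- unpacking the two flags into the hypotheses of the `mem` lemmas. [cite: Moore1966, Theorem 3.1] -/
theorem pt_flags (hnd : ptND ν1 ν2 ν3 k1 k2 k3 = true) (hok : ptOK ν1 ν2 ν3 k1 k2 k3 = true)
    (w2 w3 w4 : ℂ) :
    SliceHyp (thetaPt ν1 ν2 ν3 k1 k2 k3 w2 w3 w4) k1 k2 k3 (FI.ofRat ν1) (FI.ofRat ν2) (FI.ofRat ν3)
      ∧ (k1 ≠ k2 ∧ k2 ≠ k3) ∧ bDiagOK k1 (FI.ofRat ν1) = true ∧ bDiagOK k2 (FI.ofRat ν2) = true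
      ∧ bDiagOK k3 (FI.ofRat ν3) = true ∧ cCrossOK k1 k2 (FI.ofRat ν1) (FI.ofRat ν2) = true
      ∧ cCrossOK k2 k3 (FI.ofRat ν2) (FI.ofRat ν3) = true := by
  simp only [ptND, Bool.and_eq_true, decide_eq_true_eq] at hnd
  obtain ⟨⟨⟨⟨⟨⟨⟨hn1, hn2⟩, hn3⟩, hk1⟩, hk2⟩, hk3⟩, h12⟩, h23⟩ := hnd
  simp only [ptOK, Bool.and_eq_true] at hok
  obtain ⟨⟨⟨⟨⟨ok1, ok2⟩, ok3⟩, ok12⟩, ok23⟩, oks⟩ := hok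
  exact ⟨sliceHyp_thetaPt hn1 hn2 hn3 hk1 hk2 hk3 oks w2 w3 w4, ⟨h12, h23⟩, ok1, ok2, ok3, ok12, ok23⟩

variable {T : FI} {c : ℚ}

/-- **the constant slope forms enclose the exact entries** (derived prefactor), on any cell.
[cite: Moore1966, Theorem 3.1, §4.4] -/
theorem ptEntryS_mem (hnd : ptND ν1 ν2 ν3 k1 k2 k3 = true) (hok : ptOK ν1 ν2 ν3 k1 k2 k3 = true)
    (w2 w3 w4 : ℂ) :
    EntryS.Mem T c (ptEntryF (thetaPt ν1 ν2 ν3 k1 k2 k3 w2 w3 w4)) (ptEntryS ν1 ν2 ν3 k1 k2 k3) := by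
  obtain ⟨H, ⟨h12, h23⟩, ok1, ok2, ok3, ok12, ok23⟩ := pt_flags hnd hok w2 w3 w4
  obtain ⟨h11, h22, h33, h12', h34'⟩ := H.mem_cEntries h12 h23 ok1 ok2 ok3 ok12 ok23
  exact ⟨SFI.mem_const h11.1, SFI.mem_const h22.1, SFI.mem_const h33.1, SCB.mem_const h12',
    SCB.mem_const h34', SCB.mem_const H.mem_F20T, SCB.mem_const H.mem_F21T,
    SCB.mem_const H.mem_F30T, SCB.mem_const H.mem_F31T⟩

/-- the printed-prefactor cross entry in its box. [cite: Moore1966, Theorem 3.1] -/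
theorem pt_mem_c34P (hnd : ptND ν1 ν2 ν3 k1 k2 k3 = true) (hok : ptOK ν1 ν2 ν3 k1 k2 k3 = true)
    (w2 w3 w4 : ℂ) :
    CB.mem ((((thetaPt ν1 ν2 ν3 k1 k2 k3 w2 w3 w4).nu2 / (thetaPt ν1 ν2 ν3 k1 k2 k3 w2 w3 w4).nu1 : ℝ) : ℂ)
        * cCrossR (thetaPt ν1 ν2 ν3 k1 k2 k3 w2 w3 w4).k2 (thetaPt ν1 ν2 ν3 k1 k2 k3 w2 w3 w4).k3
          (thetaPt ν1 ν2 ν3 k1 k2 k3 w2 w3 w4).nu2 (thetaPt ν1 ν2 ν3 k1 k2 k3 w2 w3 w4).nu3)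
      ((cCrossBL k2 k3 (FI.ofRat ν2) (FI.ofRat ν3)).mulFI (FI.ofRat (ν2 / ν1))) := by
  obtain ⟨H, ⟨h12, h23⟩, ok1, ok2, ok3, ok12, ok23⟩ := pt_flags hnd hok w2 w3 w4
  obtain ⟨-, -, -, -, h34'⟩ := H.mem_cEntries h12 h23 ok1 ok2 ok3 ok12 ok23
  rw [mul_comm, thetaPt_ratio]
  exact CB.mem_mulFI h34' (FI.mem_ofRat _)

/-- **the constant slope forms enclose the exact entries** (printed prefactor), on any cell.
[cite: Moore1966, Theorem 3.1, §4.4] -/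
theorem ptEntrySP_mem (hnd : ptND ν1 ν2 ν3 k1 k2 k3 = true) (hok : ptOK ν1 ν2 ν3 k1 k2 k3 = true)
    (w2 w3 w4 : ℂ) :
    EntryS.Mem T c (ptEntryFP (thetaPt ν1 ν2 ν3 k1 k2 k3 w2 w3 w4)) (ptEntrySP ν1 ν2 ν3 k1 k2 k3) := by
  obtain ⟨m11, m22, m33, m12, -, mF20, mF21, mF30, mF31⟩ := ptEntryS_mem (T := T) (c := c) hnd hok w2 w3 w4
  exact ⟨m11, m22, m33, m12, SCB.mem_const (pt_mem_c34P hnd hok w2 w3 w4), mF20, mF21, mF30, mF31⟩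

/-! ### The leaves and the transfer to every `ι` -/

/-- **leaf, derived reading**: non-degenerate design, boxes valid, and the `LDLᴴ` pivots of the
width-0 box table of `QD θ m` certify positive semidefiniteness. [cite: Rump2006, §1] -/
def ptCertD (ν1 ν2 ν3 k1 k2 k3 m : ℚ) : Bool :=
  ptND ν1 ν2 ν3 k1 k2 k3 && ptOK ν1 ν2 ν3 k1 k2 k3
    && (ptEntryS ν1 ν2 ν3 k1 k2 k3).pivotsPos m (FI.ofInt 0) 0

/-- **leaf, printed-prefactor reading**. [cite: Rump2006, §1] -/
def ptCertP (ν1 ν2 ν3 k1 k2 k3 m : ℚ) : Bool :=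
  ptND ν1 ν2 ν3 k1 k2 k3 && ptOK ν1 ν2 ν3 k1 k2 k3
    && (ptEntrySP ν1 ν2 ν3 k1 k2 k3).pivotsPos m (FI.ofInt 0) 0

/-- the dummy cell point. [folklore] -/
private theorem mem_zero_cell : FI.mem (0 : ℝ) (FI.ofInt 0) := by simpa using FI.mem_ofInt 0

/-- **from an accepted leaf to the floor for every `ι`**, derived reading: `m ≤ C₂₃₂ᴰ(θ)` for
`θ = thetaPt … ι`, all `ι ∈ ℂ³` (the entries do not see `ι`). [cite: Zhang2022LandauSiegel, (2.32), §18 p.99] -/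
theorem C232D_pt_ge {m : ℚ} (h : ptCertD ν1 ν2 ν3 k1 k2 k3 m = true) (w2 w3 w4 : ℂ) :
    (m : ℝ) ≤ C232D (thetaPt ν1 ν2 ν3 k1 k2 k3 w2 w3 w4) := by
  unfold ptCertD at h
  simp only [Bool.and_eq_true] at h
  obtain ⟨⟨hnd, hok⟩, hpos⟩ := h
  have hpsd := EntryS.posSemidef_on_cell (ptEntryS_mem hnd hok w2 w3 w4) hpos mem_zero_cell
  rw [ptEntryF_Q] at hpsd
  exact C232D_ge_of_QD_posSemidef _ hpsd

/-- **from an accepted leaf to the floor for every `ι`**, printed-prefactor reading: `m ≤ C₂₃₂ᴾ(θ)`.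
[cite: Zhang2022LandauSiegel, (2.32), (9.5)–(9.7), §18 p.99] -/
theorem C232P_pt_ge {m : ℚ} (h : ptCertP ν1 ν2 ν3 k1 k2 k3 m = true) (w2 w3 w4 : ℂ) :
    (m : ℝ) ≤ C232P (thetaPt ν1 ν2 ν3 k1 k2 k3 w2 w3 w4) := by
  unfold ptCertP at h
  simp only [Bool.and_eq_true] at h
  obtain ⟨⟨hnd, hok⟩, hpos⟩ := h
  have hpsd := EntryS.posSemidef_on_cell (ptEntrySP_mem hnd hok w2 w3 w4) hpos mem_zero_cell
  rw [ptEntryFP_Q] at hpsd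
  exact C232P_ge_of_QPm_posSemidef _ hpsd

/-- corollary: no target `≤ m` is met by `C₂₃₂ᴰ` at the design, for any `ι` (T-print `0.001`,
T-chain `25/3000` when `m` is at least that). [cite: Zhang2022LandauSiegel, (2.32), §18 p.99] -/
theorem not_lt_C232D_pt {m : ℚ} (h : ptCertD ν1 ν2 ν3 k1 k2 k3 m = true) (w2 w3 w4 : ℂ)
    {target : ℝ} (ht : target ≤ m) : ¬ C232D (thetaPt ν1 ν2 ν3 k1 k2 k3 w2 w3 w4) < target :=
  not_lt.2 (ht.trans (C232D_pt_ge h w2 w3 w4))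

/-- the same for the printed-prefactor reading. [cite: Zhang2022LandauSiegel, (2.32), §18 p.99] -/
theorem not_lt_C232P_pt {m : ℚ} (h : ptCertP ν1 ν2 ν3 k1 k2 k3 m = true) (w2 w3 w4 : ℂ)
    {target : ℝ} (ht : target ≤ m) : ¬ C232P (thetaPt ν1 ν2 ν3 k1 k2 k3 w2 w3 w4) < target :=
  not_lt.2 (ht.trans (C232P_pt_ge h w2 w3 w4))

/-- **annex shape of a K0 point** (pattern of `RepairTiePointsCert.tiePoints_annex`): an in-class
rational design with an accepted leaf is an admissible member of `R` at which, for every `ι`, the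
reduced §18 functional of record is `≥ m` and meets no target `≤ m`.
[cite: Zhang2022LandauSiegel, (2.32), §18 p.99] -/
theorem pt_annexD {m : ℚ} (hc : ptInClass ν1 ν2 ν3 k1 k2 k3 = true)
    (h : ptCertD ν1 ν2 ν3 k1 k2 k3 m = true) (w2 w3 w4 : ℂ) :
    AdmissibleTheta (thetaPt ν1 ν2 ν3 k1 k2 k3 w2 w3 w4)
      ∧ (m : ℝ) ≤ C232D (thetaPt ν1 ν2 ν3 k1 k2 k3 w2 w3 w4)
      ∧ ∀ target : ℝ, target ≤ m → ¬ C232D (thetaPt ν1 ν2 ν3 k1 k2 k3 w2 w3 w4) < target :=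
  ⟨admissible_thetaPt hc w2 w3 w4, C232D_pt_ge h w2 w3 w4, fun _ ht => not_lt_C232D_pt h w2 w3 w4 ht⟩

end Repair

end Literature.NumberTheory.LFunctions.Zhang2022
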